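import Literature.Computability.AlgebraicComplexity.AndrewsForbes2022Prop72Proofs
import Literature.Computability.AlgebraicComplexity.AndrewsForbes2022Lemma67Proofs
import Literature.Computability.AlgebraicComplexity.AndrewsForbes2022BorderComposition
import Literature.Computability.AlgebraicComplexity.ArithCircuitComposition

/-!
# Andrews–Forbes 2022, Theorem 6.8 — the recursive generator `G_k` hits the closure of small
# low-depth circuits: EXPLICIT form and the printed asymptotic form, PROVED

R. Andrews, M. A. Forbes, *Ideals, determinants, and straightening: proving and using lower bounds
for polynomial ideals*, STOC 2022 = arXiv:2112.00792 [`AndrewsForbes2022`], §6.2, **Theorem 6.8**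
(statement p0034:L45–L57, proof p0034:L59–p0035:L39; locators `pNNNN:Lnn` are chunk files of
`lit read paper:arxiv-2112.00792`) — the paper's headline UNCONDITIONAL PIT result (informal
Thm. 1.4, first half, p0008:L24): over a field of characteristic zero, for every fixed `k` the
generator `G_k` (seed length `n^{1/2^k} s^{o(1)}`, degree `2^k`, computable in product-depth `k`
and size `n s^{o(1)}`) is a hitting set generator for the closure of `n`-variate size-`s`
product-depth-`Δ` circuits, `Δ ≤ o(log log log n)`.  The companion statement file
`AndrewsForbes2022Applications.lean` (val-lit row AndrewsForbes2022-B) recorded Thm. 6.8 as NOT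
typed ("a family of statements whose every parameter is an unnamed `o(1)`/`ω(1)`; its typable
mathematical core is the one-step generator, Lemma 6.7, iterated `k` times … iterating it in the
tree needs a composition calculus for `productDepthEdgeClass`").  Both obstacles are now gone:
Lemma 6.7 is a tree theorem (`AndrewsForbes2022_lemma_6_7_holds`, `AndrewsForbes2022Lemma67Proofs`)
and the composition calculus is `ArithCircuit.compose` (`ArithCircuitComposition.lean`: wires add,
product-depths add).  This file types AND PROVES Thm. 6.8 on top of them, following the printed
proof step by step:

* **The construction is Prop. 7.2's** (p0034:L76–L80 = p0037:L6–L12 verbatim: "Arrange the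
  variables `w⃗` into a `√n_{k-1} × √n_{k-1}` matrix and let
  `G_k(Y,Z) := G_{k-1}(𝒢_{√n_{k-1},√n_{k-1},r_k}(Y,Z))`"): the tree's `Proposition72.iterGen F ν r₁
  [r_k, …, r_2]` with its seed-length and degree bookkeeping (`Proposition72.card_iterSeed`,
  `Proposition72.totalDegree_iterGen_le`, `Proposition72.arrange`) is REUSED, not re-declared.
* **The induction step** (p0034:L70–L75: "`G_{k-1}` hits `Φ` even when `ε = 0`, so
  `Φ(G_{k-1}(w⃗)) ≠ 0` …; the composition `Φ(G_{k-1}(w⃗))` can be computed by a circuit of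
  product-depth `Δ + k - 1` and size `s + n s^{o(1)}`; Lemma 6.7 implies that
  `𝒢_{√n_{k-1},√n_{k-1},r_k}` hits `Φ(G_{k-1}(w⃗))` even when `ε = 0`") is the composition principle
  **`IsHittingSetGenFor.borderLowDepth_comp`**: if `G` hits the closure of the `M`-variate circuits
  of wire size `s` and product-depth `Δ`, every coordinate `G_m` lies in
  `productDepthEdgeClass F τ W D`, and `G'` hits the closure of the circuits of wire size
  `≥ s + |M| W` and product-depth `≥ Δ + D` in the seed variables of `G`, then `G ∘ G'` hits the
  closure of the `M`-variate size-`s` product-depth-`Δ` circuits (`ArithCircuit.edgeSize_compose`,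
  `ArithCircuit.productDepth_compose_le`, change of coefficients `F ↪ F((ε))` by
  `ArithCircuit.map`); the arrangement into a larger square is
  `IsHittingSetGenFor.borderLowDepth_comp_injective` (`DepthThreeChasm.edgeSize_rename`,
  `DepthThreeChasm.productDepth_rename`).
* **The circuit bookkeeping** (p0035:L23–L27: "We can compute `𝒢_{√n_{k-1},√n_{k-1},r_k}(Y,Z)`
  with a circuit of product-depth `1` and size `O(n_{k-1} r_k)` … Composing these circuits yields a
  circuit computing `G_k(Y,Z)` of product-depth `k`"): every coordinate `Σ_l y_{i,l} z_{l,j}` of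
  `𝒢_{n,m,r}` is a product-depth-`1` circuit with `≤ 3r` wires
  (`matrixGenerator_mem_productDepthEdgeClass`; this is Lemma 2.9 (3), circuit clause, per
  coordinate), every coordinate of `G_k` is a product-depth-`≤ k` circuit with `≤ W_k` wires,
  `W_1 = 3 r_1`, `W_j = W_{j-1} + n_{j-1} · 3 r_j` (`Theorem68.iterWBound`,
  `Theorem68.mem_productDepthEdgeClass_iterGen`), and — print's multi-output reading — ONE shared
  gate list of `≤ T_k` wires, `T_1 = 3 n r_1`, `T_j = T_{j-1} + n_{j-1} · 3 r_j`, computes all `n`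
  coordinates as outputs of product-depth `≤ k`, with every product gate of fan-in `≤ 2`
  (`Theorem68.iterTBound`, `Theorem68.exists_jointGates_iterGen`; the tree's `ArithCircuit` is
  single-output, so a multi-output circuit is a gate list with one output operand per coordinate).
* **The explicit hitting theorem** (`Theorem68.iterGen_isHittingSetGenFor`, summary
  **`AndrewsForbes2022_thm_6_8_explicit`**): with `(c, s₀(·))` the constant and thresholds of
  Lemma 6.7 as typed (`AndrewsForbes2022_lemma_6_7`: universal `c`, threshold `s₀` chosen after
  `Δ`), `G_k` hits the closure of the `ν²`-variate circuits of wire size `s` and product-depth `Δ`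
  as soon as the explicit per-step conditions `Theorem68.IterHyp` hold: at step `j` (inner
  generator of rank `r_j` against the compositions `Φ ∘ G_{j-1}`, of wire size
  `s_j = s + ν² W_{j-1}` and product-depth `Δ_j = Δ + (j - 1)`), `s_j ≥ s₀(Δ_j)`,
  `r_j + 1 ≥ 2^{(log₂ s_j)^{1 - exp(-c Δ_j)}}` (print's "`r_k = 2^{log(s^{1+o(1)})^{1-exp(-c(Δ+k-1))}}`",
  p0034:L82–L84), and the characteristic condition `char F = 0 ∨ char F > s_j^{Δ_j}` of Lemma 6.7
  — EVERY field: for `char F = 0` the last condition is void (Thm. 6.8 as printed), and for a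
  fixed number of steps it is met by all fields of sufficiently large characteristic, which is
  exactly the last sentence of **Remark 6.9** (p0035:L41–L45: "for any fixed `k`, the generator
  `G_k` can be constructed over fields of sufficiently large characteristic"); the rest of
  Rem. 6.9 (why no single positive characteristic works for all `k`) is prose and not formalized.
* **The printed asymptotic form** (**`AndrewsForbes2022_thm_6_8_asymptotic`**, section
  `Asymptotic`): `char F = 0`; for every fixed `k ≥ 1`, every fixed product-depth `Δ ≥ 1` and every
  `δ > 0` there is `s₀` such that for all `s ≥ s₀` and all `n = ν² ≤ s` (`1 ≤ ν`; the regime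
  `n ≤ s` implicit in print's "`Δ ≤ o(log log log n) ≤ o(log log log s)`", p0035:L2) there are
  ranks with: `G_k` hits the closure of the `n`-variate size-`s` product-depth-`Δ` circuits,
  (bullet 1) seed length `≤ n^{1/2^k} s^δ`, (bullet 2) degree `≤ 2^k`, (bullet 3) one shared gate
  list of wire size `≤ n s^δ` (product gates of fan-in `≤ 2`) computing every coordinate as an
  output of product-depth `≤ k` (`Theorem68.exists_params`: the printed parameter analysis with
  explicit constants).  DEGREE, disclosed: print states `deg(G_k) = 2^k` (an equality); typed is
  the upper bound `≤ 2^k` on every coordinate (`Proposition72.totalDegree_iterGen_le`, as for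
  Prop. 7.2 (2)) — weaker than print as a statement about `G_k`, and all that the hitting-set use
  and the seed-length/degree trade-off (Lemma 2.6) consume.
  RATE HYPOTHESIS, disclosed: print allows the product-depth to grow as
  `Δ ≤ o(log log log n)`; this file renders the statement for each FIXED `Δ` (a constant function
  is `o(log log log n)`, so this is an instance of the printed family, not all of it) — the typed
  Lemma 6.7 chooses its threshold `s₀` after `Δ` with no rate, so a growing `Δ(n)` cannot be fed
  through it (`TODO(general form)`: needs a `Δ`-explicit threshold in Lemma 6.7).  NOT formalized:
  bullet (4) (size `n log^{O(1)} n` for `s ≤ n^{O(1)}` via Coppersmith's rectangular matrix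
  multiplication [Cop82], not in the tree), as for Prop. 7.2; bullet (3)'s fan-in remark is
  rendered as "every product gate has fan-in `≤ 2`".

No named facts are introduced (D-0026): definitions with bodies and proved theorems only, on top
of `AndrewsForbes2022_lemma_6_7_holds`.

Honest framing: kernel-checked transcription of a published (2022) unconditional PIT construction
for constant-depth circuits (typed literature for the val-lit NP corpus, V4 companion of GAP row
N7); VP ≠ VNP is NOT proved and nothing here is progress on it.  (val-lit t24 g7, 2026-08-27.)

## References

* [AndrewsForbes2022] R. Andrews, M. A. Forbes, STOC 2022, doi:10.1145/3519935.3520025,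
  arXiv:2112.00792 — Thm. 6.8 (p. 48–49 of the arXiv version; chunks p0034–p0035), Rem. 6.9,
  Lemma 6.7, Lemma 2.9, Construction 2.8, Prop. 7.2 (the same recursion).
* [LimayeSrinivasanTavenas2021] N. Limaye, S. Srinivasan, S. Tavenas, FOCS 2021 (size = wires).
-/

noncomputable section

open MvPolynomial

namespace Literature.Computability.AlgebraicComplexity

universe u v w

/-! ## The induction step of Thm. 6.8: composition of hitting set generators for closures of
low-depth circuits -/

section Composition

variable {F : Type u} [Field F]

/-- `productDepthEdgeClass` is monotone in both the wire bound and the product-depth bound.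
[cite: AndrewsForbes2022, §6.1 (Cor. 6.5)] -/
theorem productDepthEdgeClass_mono₂ (k : Type u) [CommSemiring k] (M : Type v) {s s' Δ Δ' : ℕ}
    (hs : s ≤ s') (hΔ : Δ ≤ Δ') : productDepthEdgeClass k M s Δ ⊆ productDepthEdgeClass k M s' Δ' := by
  rintro f ⟨P, hc, hPΔ, hPs⟩
  exact ⟨P, hc, hPΔ.trans hΔ, hPs.trans hs⟩

/-- The closure of the wire-size-`s` product-depth-`Δ` circuits is stable under renaming the
variables along any map (rename the approximating circuit: wires and product-depth are kept,
`DepthThreeChasm.edgeSize_rename` / `productDepth_rename`). [cite: AndrewsForbes2022, §2.1 (closure of a class)] -/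
theorem rename_mem_borderClass_productDepthEdgeClass {σ : Type v} {τ : Type w} {s Δ : ℕ}
    {f : MvPolynomial σ F}
    (hf : f ∈ borderClass F (productDepthEdgeClass (LaurentSeries F) σ s Δ)) (ι : σ → τ) :
    rename ι f ∈ borderClass F (productDepthEdgeClass (LaurentSeries F) τ s Δ) := by
  obtain ⟨h, ⟨P, hPh, hPΔ, hPs⟩, hhf⟩ := hf
  refine ⟨rename ι h, ⟨P.rename ι, hPh.rename ι, ?_, ?_⟩, ?_⟩
  · rw [DepthThreeChasm.productDepth_rename]; exact hPΔ
  · rw [DepthThreeChasm.edgeSize_rename]; exact hPs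
  · have : rename ι h - MvPolynomial.map (algebraMap F (LaurentSeries F)) (rename ι f) =
        rename ι (h - MvPolynomial.map (algebraMap F (LaurentSeries F)) f) := by
      rw [map_sub, map_rename]
    rw [this]
    exact polyOrdGE_rename hhf ι

/-- **Arranging the seed into a larger set of variables** (proof of Thm. 6.8, p0034:L76:
"Arrange the variables `w⃗` into a `√n_{k-1} × √n_{k-1}` matrix"): if `G : τ' → F[y]` hits the
closure of the `τ'`-variate circuits of wire size `s` and product-depth `Δ` and `ι : τ ↪ τ'` is
injective, then `G ∘ ι` hits the closure of the `τ`-variate ones (`g(G ∘ ι) = (rename ι g)(G)`).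
[cite: AndrewsForbes2022, Thm. 6.8 (proof)] -/
theorem IsHittingSetGenFor.borderLowDepth_comp_injective {τ : Type v} {τ' : Type w} {κ : Type}
    {s Δ : ℕ} {G : τ' → MvPolynomial κ F}
    (hG : IsHittingSetGenFor F (borderClass F (productDepthEdgeClass (LaurentSeries F) τ' s Δ)) G)
    {ι : τ → τ'} (hι : Function.Injective ι) :
    IsHittingSetGenFor F (borderClass F (productDepthEdgeClass (LaurentSeries F) τ s Δ)) (G ∘ ι) := by
  intro g hg hg0
  rw [← bind₁_rename]
  exact hG (rename ι g) (rename_mem_borderClass_productDepthEdgeClass hg ι)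
    (fun h0 => hg0 (rename_injective ι hι (by rw [h0, map_zero])))

/-- **The induction step of Thm. 6.8** (p0034:L70–L86), as a composition principle for hitting
set generators of closures of low-depth circuits: let `G : M → F[w]` hit the closure of the
`M`-variate circuits of wire size `s` and product-depth `Δ`, each coordinate `G_m` being computed
by a circuit with `≤ W` wires and product-depth `≤ D`, and let `G' : τ → F[y]` hit the closure of
the circuits of wire size `s'` and product-depth `Δ'` in the seed variables `w` of `G`, where
`s + |M| · W ≤ s'` and `Δ + D ≤ Δ'`.  Then `G ∘ G'` (`x_m ↦ G_m(G'(y))`) hits the closure of the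
`M`-variate circuits of wire size `s` and product-depth `Δ`.  Printed argument: for
`Φ = f + O(ε)` of size `s`, product-depth `Δ`, with `f ≠ 0`: `f(G(w)) ≠ 0` ("`G_{k-1}` hits `Φ`
even when `ε = 0`"), and `Φ(G(w)) = f(G(w)) + O(ε)` is computed by the composed circuit of wire
size `≤ s + |M| W` and product-depth `≤ Δ + D` (`ArithCircuit.compose`: the circuits of the `G_m`
feed the inputs of `Φ`; "the composition `Φ(G_{k-1}(w⃗))` can be computed by a circuit of
product-depth `Δ + k - 1` and size `s + n s^{o(1)}`"), so `G'` hits it: `f(G(G'(y))) ≠ 0`.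
[cite: AndrewsForbes2022, Thm. 6.8 (proof)] -/
theorem IsHittingSetGenFor.borderLowDepth_comp {M : Type v} {τ : Type w} {τ' : Type} [Fintype M]
    {s Δ W D s' Δ' : ℕ} {G : M → MvPolynomial τ F} {G' : τ → MvPolynomial τ' F}
    (hG : IsHittingSetGenFor F (borderClass F (productDepthEdgeClass (LaurentSeries F) M s Δ)) G)
    (hW : ∀ m, G m ∈ productDepthEdgeClass F τ W D)
    (hs : s + Fintype.card M * W ≤ s') (hΔ : Δ + D ≤ Δ')
    (hG' : IsHittingSetGenFor F
      (borderClass F (productDepthEdgeClass (LaurentSeries F) τ s' Δ')) G') :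
    IsHittingSetGenFor F (borderClass F (productDepthEdgeClass (LaurentSeries F) M s Δ))
      (fun m => bind₁ G' (G m)) := by
  intro f hf hf0
  rw [← bind₁_bind₁]
  obtain ⟨h, ⟨P, hPh, hPΔ, hPs⟩, hhf⟩ := hf
  -- `g = f(G(w)) ≠ 0` by the hitting property of `G`
  have hg0 : bind₁ G f ≠ 0 := hG f ⟨h, ⟨P, hPh, hPΔ, hPs⟩, hhf⟩ hf0
  -- circuits for the coordinates of `G`, with coefficients moved to `F((ε))`
  choose Q hQc hQΔ hQs using hW
  set φ : F →+* LaurentSeries F := algebraMap F (LaurentSeries F) with hφ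
  have hQ' : ∀ m, ((Q m).map φ).Computes (MvPolynomial.map φ (G m)) := fun m => by
    rw [ArithCircuit.Computes, ArithCircuit.eval_map_apply, (hQc m : (Q m).eval = G m)]
  -- `Φ(G(w)) = g + O(ε)` is computed by the composed circuit
  have hmem : bind₁ G f ∈ borderClass F (productDepthEdgeClass (LaurentSeries F) τ s' Δ') := by
    refine ⟨bind₁ (fun m => MvPolynomial.map φ (G m)) h, ?_, ?_⟩
    · refine productDepthEdgeClass_mono₂ _ _ hs hΔ ?_
      refine ⟨P.compose fun m => (Q m).map φ, hPh.compose_bind₁ hQ', ?_, ?_⟩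
      · refine (ArithCircuit.productDepth_compose_le (D := D) (fun m => ?_) P).trans
          (Nat.add_le_add_right hPΔ D)
        rw [ArithCircuit.productDepth_mapCoeff]
        exact hQΔ m
      · rw [ArithCircuit.edgeSize_compose]
        refine Nat.add_le_add hPs ?_
        calc ∑ m, ((Q m).map φ).edgeSize = ∑ m, (Q m).edgeSize := by
              simp only [ArithCircuit.edgeSize_mapCoeff]
          _ ≤ ∑ _m : M, W := Finset.sum_le_sum fun m _ => hQs m
          _ = Fintype.card M * W := by rw [Finset.sum_const, smul_eq_mul, Finset.card_univ]
    · rw [map_bind₁, ← map_sub]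
      exact hhf.bind₁ fun m => PolyOrdGE.map_algebraMap (G m)
  exact hG' _ hmem hg0

end Composition

/-! ## Circuits for the coordinates of `𝒢_{n,m,r}` and of `G_k` (wires and product-depth) -/

section Circuits

variable (F : Type u) [Field F]

/-- Each coordinate `Σ_{l < r} y_{i,l} z_{l,j}` of `𝒢_{n,m,r}` has at most `r` monomials.
[cite: AndrewsForbes2022, Lemma 2.9] -/
theorem card_support_matrixGenerator_le (n m r : ℕ) (ij : Fin n × Fin m) :
    (matrixGenerator F n m r ij).support.card ≤ r := by
  classical
  unfold matrixGenerator
  refine (Finset.card_le_card support_sum).trans ?_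
  refine (Finset.card_biUnion_le).trans ?_
  calc ∑ l : Fin r, (X (Sum.inl (ij.1, l)) * X (Sum.inr (l, ij.2)) :
          MvPolynomial (MatGenSeed n m r) F).support.card
      ≤ ∑ _l : Fin r, 1 := Finset.sum_le_sum fun l _ => by
        rw [support_X_mul, Finset.card_map, support_X, Finset.card_singleton]
    _ = r := by simp

/-- **Lemma 2.9 (3), circuit clause, per coordinate** (p0013:L50: "`𝒢_{n,m,r}(Y,Z)` can be
computed by a (multi-output) algebraic circuit of size `2nmr` and product-depth `1`"): every
coordinate of `𝒢_{n,m,r}` is computed by a product-depth-`1` circuit with at most `3r` wires (the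
`ΣΠ` circuit of its `≤ r` quadratic monomials: `2` wires per product gate, `1` per summand; the
printed `2nmr` counts the `nm` coordinates together, in print's node/edge convention).
[cite: AndrewsForbes2022, Lemma 2.9] -/
theorem matrixGenerator_mem_productDepthEdgeClass (n m r : ℕ) (ij : Fin n × Fin m) :
    matrixGenerator F n m r ij ∈ productDepthEdgeClass F (MatGenSeed n m r) (3 * r) 1 := by
  obtain ⟨C, hC, hCΔ, hCs⟩ := DepthThreeChasm.exists_sumOfMonomials_circuit (matrixGenerator F n m r ij)
  refine ⟨C, hC, hCΔ, hCs.trans ?_⟩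
  calc (matrixGenerator F n m r ij).support.card * ((matrixGenerator F n m r ij).totalDegree + 1)
      ≤ r * (2 + 1) := Nat.mul_le_mul (card_support_matrixGenerator_le F n m r ij)
        (Nat.succ_le_succ (totalDegree_matrixGenerator_le n m r ij))
    _ = 3 * r := by ring

/-- The coordinate circuit of `𝒢_{n,m,r}` with its gate structure exposed: the `ΣΠ` circuit of the
`≤ r` quadratic monomials of `Σ_l y_{i,l} z_{l,j}` (`ArithCircuit.sumOfMonomials`) computes the
coordinate with product-depth `≤ 1`, `≤ 3r` wires, and **every product gate of fan-in `≤ 2`** (a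
monomial gate has fan-in = the degree of its monomial; Thm. 6.8 (3): "each product gate in this
circuit has fan-in `2`"). [cite: AndrewsForbes2022, Lemma 2.9] -/
theorem exists_matrixGenerator_circuit (n m r : ℕ) (ij : Fin n × Fin m) :
    ∃ C : ArithCircuit F (MatGenSeed n m r), C.Computes (matrixGenerator F n m r ij) ∧
      C.productDepth ≤ 1 ∧ C.edgeSize ≤ 3 * r ∧
      ∀ g ∈ C.gates, g.isProd = true → g.fanIn ≤ 2 := by
  classical
  obtain ⟨f, hf⟩ : ∃ f, f = matrixGenerator F n m r ij := ⟨_, rfl⟩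
  refine ⟨ArithCircuit.sumOfMonomials f.support.toList f, ?_,
    ArithCircuit.productDepth_sumOfMonomials_le _ _, ?_, ?_⟩
  · rw [← hf]
    exact ArithCircuit.computes_sumOfMonomials (Finset.nodup_toList _)
      (fun _ hm => Finset.mem_toList.mpr hm)
  · rw [hf]
    refine (DepthThreeChasm.edgeSize_sumOfMonomials_le _ (D := 2) fun μ hμ => ?_).trans ?_
    · rw [Finsupp.card_toMultiset]
      exact (le_totalDegree (Finset.mem_toList.1 hμ)).trans (totalDegree_matrixGenerator_le n m r ij)
    · rw [Finset.length_toList]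
      calc (matrixGenerator F n m r ij).support.card * (2 + 1) ≤ r * (2 + 1) :=
            Nat.mul_le_mul_right _ (card_support_matrixGenerator_le F n m r ij)
        _ = 3 * r := by ring
  · intro g hg hprod
    change g ∈ DepthReduction.layerM f.support.toList ++ [DepthReduction.pieceGate f.support.toList f] at hg
    rw [List.mem_append, List.mem_singleton] at hg
    rcases hg with hg | rfl
    · obtain ⟨μ, hμ, rfl⟩ := List.mem_map.1 hg
      rw [DepthThreeChasm.fanIn_monomialGate, Finsupp.card_toMultiset]
      refine (le_totalDegree (Finset.mem_toList.1 hμ)).trans ?_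
      rw [hf]
      exact totalDegree_matrixGenerator_le n m r ij
    · exact absurd hprod (by simp [DepthReduction.pieceGate, ArithCircuit.Gate.isProd])

/-- Product gates keep their fan-in under juxtaposition: if every product gate of every `Q ∈ L`
has fan-in `≤ 2`, so does every product gate of `juxtGates L`. [cite: Burgisser2000, proof of Prop. 2.3] -/
theorem prodFanIn_juxtGates {k : Type u} {τ : Type w} {L : List (ArithCircuit k τ)}
    (hL : ∀ Q ∈ L, ∀ g ∈ Q.gates, g.isProd = true → g.fanIn ≤ 2) :
    ∀ g ∈ ArithCircuit.juxtGates L, g.isProd = true → g.fanIn ≤ 2 := by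
  induction L with
  | nil => simp [ArithCircuit.juxtGates]
  | cons Q L ih =>
    intro g hg hprod
    simp only [ArithCircuit.juxtGates, List.mem_append, List.mem_map] at hg
    rcases hg with hg | ⟨g', hg', rfl⟩
    · exact hL Q (by simp) g hg hprod
    · have h1 : (g'.shift Q.size).fanIn = g'.fanIn := by
        cases g' <;> simp [ArithCircuit.Gate.shift, ArithCircuit.Gate.fanIn, ArithCircuit.Gate.args]
      have h2 : (g'.shift Q.size).isProd = g'.isProd := by cases g' <;> rfl
      rw [h1]
      rw [h2] at hprod
      exact ih (fun R hR => hL R (by simp [hR])) g' hg' hprod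

/-- Product gates keep their fan-in under composition (`ArithCircuit.compose`: the juxtaposed
input circuits, then the transported gates of `P`). [cite: Burgisser2000, Rem. 2.7] -/
theorem prodFanIn_compose {k : Type u} [Zero k] {σ : Type v} {τ : Type w} [Fintype σ]
    {P : ArithCircuit k σ} {Q : σ → ArithCircuit k τ}
    (hP : ∀ g ∈ P.gates, g.isProd = true → g.fanIn ≤ 2)
    (hQ : ∀ i, ∀ g ∈ (Q i).gates, g.isProd = true → g.fanIn ≤ 2) :
    ∀ g ∈ (P.compose Q).gates, g.isProd = true → g.fanIn ≤ 2 := by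
  intro g hg hprod
  change g ∈ ArithCircuit.juxtGates (ArithCircuit.compList Q) ++
    P.gates.map (ArithCircuit.Gate.subst (ArithCircuit.compOperand Q)
      (ArithCircuit.juxtGates (ArithCircuit.compList Q)).length) at hg
  rw [List.mem_append, List.mem_map] at hg
  rcases hg with hg | ⟨g', hg', rfl⟩
  · refine prodFanIn_juxtGates (fun R hR => ?_) g hg hprod
    rw [ArithCircuit.compList, List.mem_ofFn] at hR
    obtain ⟨j, rfl⟩ := hR
    exact hQ _
  · rw [ArithCircuit.Gate.fanIn_subst]
    rw [ArithCircuit.Gate.isProd_subst_eq] at hprod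
    exact hP g' hg' hprod

end Circuits

namespace Theorem68

open Proposition72

/-- **The wire bound `W_k` for the coordinates of `G_k`** (p0035:L23–L27, "Circuit size", made
explicit per coordinate): `W_1 = 3 r_1` (a coordinate of `𝒢_{ν,ν,r_1}`), and
`W_j = W_{j-1} + n_{j-1} · 3 r_j` — the circuit of a coordinate of `G_{j-1}` (`≤ W_{j-1}` wires,
`n_{j-1} = 2 ν_{j-2} r_{j-1}` inputs) composed with one `3 r_j`-wire circuit per input (print:
"`O(n_{k-1} r_k)`" for the inner generator, then "Composing these circuits").
[cite: AndrewsForbes2022, Thm. 6.8 (proof, "Circuit size")] -/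
def iterWBound (ν r₁ : ℕ) : List ℕ → ℕ
  | [] => 3 * r₁
  | r :: rs => iterWBound ν r₁ rs + 2 * (lastSide ν r₁ rs * lastRank r₁ rs) * (3 * r)

/-- **Wires and product-depth of `G_k`** (Thm. 6.8, bullet 3, explicit form; p0035:L23–L27):
every coordinate of `G_k = iterGen ν r₁ [r_k, …, r_2]` is computed by a circuit of product-depth
`≤ k` with at most `W_k` wires (`iterWBound`).  Proof = the printed composition: the coordinate
circuit of `G_{k-1}` with the product-depth-`1` circuits of the inner `𝒢_{ν_{k-1},ν_{k-1},r_k}`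
substituted for its inputs (`ArithCircuit.compose`, `edgeSize_compose`, `productDepth_compose_le`).
[cite: AndrewsForbes2022, Thm. 6.8 (3)] -/
theorem mem_productDepthEdgeClass_iterGen (F : Type u) [Field F] (ν r₁ : ℕ) :
    ∀ (rs : List ℕ) (m : Fin ν × Fin ν),
      iterGen F ν r₁ rs m ∈ productDepthEdgeClass F (IterSeed ν r₁ rs) (iterWBound ν r₁ rs) (rs.length + 1)
  | [], m => matrixGenerator_mem_productDepthEdgeClass F ν ν r₁ m
  | r :: rs, m => by
    obtain ⟨P, hP, hPΔ, hPs⟩ := mem_productDepthEdgeClass_iterGen F ν r₁ rs m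
    choose Q hQ hQΔ hQs using fun i : IterSeed ν r₁ rs =>
      (matrixGenerator_mem_productDepthEdgeClass F (lastSide ν r₁ (r :: rs)) (lastSide ν r₁ (r :: rs)) r
        (arrange (lastSide ν r₁ rs) (lastRank r₁ rs) i) :
        matrixGenerator F _ _ r (arrange (lastSide ν r₁ rs) (lastRank r₁ rs) i) ∈
          productDepthEdgeClass F (IterSeed ν r₁ (r :: rs)) (3 * r) 1)
    refine ⟨P.compose Q, ?_, ?_, ?_⟩
    · rw [iterGen]
      exact hP.compose_bind₁ hQ
    · refine (ArithCircuit.productDepth_compose_le (D := 1) hQΔ P).trans ?_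
      rw [List.length_cons]
      exact Nat.add_le_add_right hPΔ 1
    · rw [ArithCircuit.edgeSize_compose, iterWBound]
      refine Nat.add_le_add hPs ?_
      calc ∑ i, (Q i).edgeSize ≤ ∑ _i : IterSeed ν r₁ rs, 3 * r := Finset.sum_le_sum fun i _ => hQs i
        _ = 2 * (lastSide ν r₁ rs * lastRank r₁ rs) * (3 * r) := by
            rw [Finset.sum_const, smul_eq_mul, Finset.card_univ, card_iterSeed]

/-- **The total wire bound `T_k` for ALL `n = ν²` coordinates of `G_k` computed JOINTLY by one
gate list** (p0035:L23–L27, "Circuit size": "We can compute `𝒢_{√n_{k-1},√n_{k-1},r_k}(Y,Z)` with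
a circuit of product-depth `1` and size `O(n_{k-1} r_k)` … By induction, we can compute
`G_{k-1}(w⃗)` with a circuit of product-depth `k - 1` and size `n s^{o(1)}`.  Composing these
circuits yields a circuit computing `G_k(Y,Z)` of product-depth `k` and size `n s^{o(1)}`"):
`T_1 = ν² · 3 r_1` (the `ν²` coordinate circuits of `𝒢_{ν,ν,r_1}` side by side) and
`T_j = T_{j-1} + n_{j-1} · 3 r_j` (the inner generator's `n_{j-1}` used coordinates, `3 r_j` wires
each, feeding the shared gate list of `G_{j-1}`). [cite: AndrewsForbes2022, Thm. 6.8 (proof, "Circuit size")] -/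
def iterTBound (ν r₁ : ℕ) : List ℕ → ℕ
  | [] => ν * ν * (3 * r₁)
  | r :: rs => iterTBound ν r₁ rs + 2 * (lastSide ν r₁ rs * lastRank r₁ rs) * (3 * r)

/-- **`G_k` as ONE multi-output circuit** (Thm. 6.8, bullet 3, explicit form, in print's
multi-output sense; p0035:L23–L27): there is a single gate list over the seed variables of `G_k`
with at most `T_k` wires (`iterTBound`), all of whose product gates have fan-in `≤ 2` (print:
"each product gate in this circuit has fan-in `2`"), against which every coordinate of `G_k` is
the value of some output operand of product-depth `≤ k` (the tree's `ArithCircuit` is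
single-output, so the multi-output circuit is presented as a shared gate list with one output
operand per coordinate).
Proof = the printed composition, sharing the gates of `G_{k-1}` among all coordinates: the
juxtaposition of the inner coordinate circuits followed by the transported shared gate list
(`ArithCircuit.compose` with a common gate list; `edgeSize_compose`, `productDepth_compose_le`).
[cite: AndrewsForbes2022, Thm. 6.8 (3)] -/
theorem exists_jointGates_iterGen (F : Type u) [Field F] (ν r₁ : ℕ) :
    ∀ rs : List ℕ, ∃ gs : List (ArithCircuit.Gate F (IterSeed ν r₁ rs)),
      (gs.map ArithCircuit.Gate.fanIn).sum ≤ iterTBound ν r₁ rs ∧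
      (∀ g ∈ gs, g.isProd = true → g.fanIn ≤ 2) ∧
      ∀ m : Fin ν × Fin ν, ∃ o : ArithCircuit.Operand F (IterSeed ν r₁ rs),
        (⟨gs, o⟩ : ArithCircuit F (IterSeed ν r₁ rs)).eval = iterGen F ν r₁ rs m ∧
        (⟨gs, o⟩ : ArithCircuit F (IterSeed ν r₁ rs)).productDepth ≤ rs.length + 1
  | [] => by
    classical
    choose C hC hCΔ hCs hC2 using fun m : Fin ν × Fin ν => exists_matrixGenerator_circuit F ν ν r₁ m
    refine ⟨ArithCircuit.juxtGates (ArithCircuit.compList C), ?_, ?_, fun m => ?_⟩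
    · rw [ArithCircuit.sum_fanIn_juxtGates, ArithCircuit.sum_map_compList, iterTBound]
      calc ∑ m, (C m).edgeSize ≤ ∑ _m : Fin ν × Fin ν, 3 * r₁ := Finset.sum_le_sum fun m _ => hCs m
        _ = ν * ν * (3 * r₁) := by
            rw [Finset.sum_const, smul_eq_mul, Finset.card_univ, Fintype.card_prod, Fintype.card_fin]
    · refine prodFanIn_juxtGates fun R hR => ?_
      rw [ArithCircuit.compList, List.mem_ofFn] at hR
      obtain ⟨j, rfl⟩ := hR
      exact hC2 _
    · refine ⟨ArithCircuit.compOperand C m, ?_, ?_⟩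
      · have h := ArithCircuit.eval_juxtOuts (ArithCircuit.compList C) (Fintype.equivFin _ m)
          (by rw [ArithCircuit.length_compList]; exact (Fintype.equivFin _ m).isLt) []
        rw [List.append_nil, ArithCircuit.getElem_compList] at h
        exact h.trans (hC m)
      · have h := ArithCircuit.depthIn_juxtOuts ArithCircuit.prodWeight (fun n g => by cases g <;> rfl)
          (ArithCircuit.compList C) (Fintype.equivFin _ m)
          (by rw [ArithCircuit.length_compList]; exact (Fintype.equivFin _ m).isLt) []
        rw [List.append_nil, ArithCircuit.getElem_compList,
          ← ArithCircuit.productDepth_eq_wdepth_prodWeight] at h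
        rw [ArithCircuit.productDepth_eq_wdepth_prodWeight]
        exact (le_of_eq h).trans (hCΔ m)
  | r :: rs => by
    obtain ⟨gs, hT, h2, hout⟩ := exists_jointGates_iterGen F ν r₁ rs
    choose Q hQ hQΔ hQs hQ2 using fun i : IterSeed ν r₁ rs =>
      (exists_matrixGenerator_circuit F (lastSide ν r₁ (r :: rs)) (lastSide ν r₁ (r :: rs)) r
        (arrange (lastSide ν r₁ rs) (lastRank r₁ rs) i) :
        ∃ C : ArithCircuit F (IterSeed ν r₁ (r :: rs)),
          C.Computes (matrixGenerator F _ _ r (arrange (lastSide ν r₁ rs) (lastRank r₁ rs) i)) ∧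
          C.productDepth ≤ 1 ∧ C.edgeSize ≤ 3 * r ∧ ∀ g ∈ C.gates, g.isProd = true → g.fanIn ≤ 2)
    -- the shared gate list: inner coordinate circuits, then the transported gates of `G_{k-1}`
    refine ⟨((⟨gs, .const 0⟩ : ArithCircuit F (IterSeed ν r₁ rs)).compose Q).gates, ?_,
      prodFanIn_compose (P := (⟨gs, .const 0⟩ : ArithCircuit F (IterSeed ν r₁ rs))) h2 hQ2,
      fun m => ?_⟩
    · have h := ArithCircuit.edgeSize_compose (⟨gs, .const 0⟩ : ArithCircuit F (IterSeed ν r₁ rs)) Q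
      have hsum : ∑ i, (Q i).edgeSize ≤ 2 * (lastSide ν r₁ rs * lastRank r₁ rs) * (3 * r) :=
        calc ∑ i, (Q i).edgeSize ≤ ∑ _i : IterSeed ν r₁ rs, 3 * r := Finset.sum_le_sum fun i _ => hQs i
          _ = 2 * (lastSide ν r₁ rs * lastRank r₁ rs) * (3 * r) := by
              rw [Finset.sum_const, smul_eq_mul, Finset.card_univ, card_iterSeed]
      calc (List.map ArithCircuit.Gate.fanIn
            ((⟨gs, .const 0⟩ : ArithCircuit F (IterSeed ν r₁ rs)).compose Q).gates).sum
          = ((⟨gs, .const 0⟩ : ArithCircuit F (IterSeed ν r₁ rs)).compose Q).edgeSize := rfl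
        _ = (List.map ArithCircuit.Gate.fanIn gs).sum + ∑ i, (Q i).edgeSize := h
        _ ≤ iterTBound ν r₁ rs + 2 * (lastSide ν r₁ rs * lastRank r₁ rs) * (3 * r) :=
            Nat.add_le_add hT hsum
        _ = iterTBound ν r₁ (r :: rs) := rfl
    · obtain ⟨o, ho, hoΔ⟩ := hout m
      refine ⟨((⟨gs, o⟩ : ArithCircuit F (IterSeed ν r₁ rs)).compose Q).output, ?_, ?_⟩
      · have h := ArithCircuit.eval_compose (⟨gs, o⟩ : ArithCircuit F (IterSeed ν r₁ rs)) Q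
        rw [ho] at h
        rw [iterGen]
        refine h.trans ?_
        have hg : (fun i => (Q i).eval) = fun i =>
            matrixGenerator F _ _ r (arrange (lastSide ν r₁ rs) (lastRank r₁ rs) i) := funext hQ
        rw [hg]
        rfl
      · have h := ArithCircuit.productDepth_compose_le (D := 1) hQΔ
          (⟨gs, o⟩ : ArithCircuit F (IterSeed ν r₁ rs))
        rw [List.length_cons]
        exact h.trans (Nat.add_le_add_right hoΔ 1)

/-- The wire size `s_k = s + ν² · W_{k-1}` of the compositions `Φ ∘ G_{k-1}` (`Φ` of wire size
`s` on the `ν²` variables; p0034:L75: "size `s + n s^{o(1)}`"). [cite: AndrewsForbes2022, Thm. 6.8 (proof)] -/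
def compSize (s ν r₁ : ℕ) (rs : List ℕ) : ℕ := s + ν * ν * iterWBound ν r₁ rs

/-- The rank threshold of Lemma 6.7 for wire size `X` and product-depth `Δ'`:
`2^{(log₂ X)^{1 - exp(-c Δ')}}` (p0033:L93; in Thm. 6.8's proof with `X = s^{1+o(1)}`,
`Δ' = Δ + k - 1`, p0034:L82–L84). [cite: AndrewsForbes2022, Lemma 6.7] -/
def rankThreshold (c : ℝ) (X Δ' : ℕ) : ℝ :=
  (2 : ℝ) ^ ((Real.logb 2 X) ^ (1 - Real.exp (-(c * Δ'))))

/-- **The explicit hypothesis on the parameters** replacing print's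
`r_k = 2^{log(s^{1+o(1)})^{1-exp(-c(Δ+k-1))}}` (p0034:L82–L84) and "`s` sufficiently large /
`char F = 0`": with `(c, s₀(·))` the constant and the thresholds of Lemma 6.7 and `p = char F`,
for `G_1`: `s ≥ s₀(Δ)`, `p = 0 ∨ p > s^Δ`, `r_1 + 1 ≥ 2^{(log₂ s)^{1-exp(-cΔ)}}` (Lemma 6.7 for
`𝒢_{ν,ν,r_1} = 𝒢_{ν,ν,(r_1+1)-1}`); and for each later step `j`, the same three conditions for the
inner generator against the compositions `Φ ∘ G_{j-1}`, of wire size `s_j = compSize` and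
product-depth `Δ_j = Δ + (j - 1)`. [cite: AndrewsForbes2022, Thm. 6.8 (proof)] -/
def IterHyp (c : ℝ) (S₀ : ℕ → ℕ) (p s Δ ν r₁ : ℕ) : List ℕ → Prop
  | [] => S₀ Δ ≤ s ∧ (p = 0 ∨ s ^ Δ < p) ∧ rankThreshold c s Δ ≤ r₁ + 1
  | r :: rs => IterHyp c S₀ p s Δ ν r₁ rs ∧
      S₀ (Δ + (rs.length + 1)) ≤ compSize s ν r₁ rs ∧
      (p = 0 ∨ compSize s ν r₁ rs ^ (Δ + (rs.length + 1)) < p) ∧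
      rankThreshold c (compSize s ν r₁ rs) (Δ + (rs.length + 1)) ≤ r + 1

/-- **`G_k` is a hitting set generator for the closure of the size-`s` product-depth-`Δ`
circuits** (Thm. 6.8, main clause, with explicit parameters; every field).  Hypothesis `H` is the
typed conclusion of Lemma 6.7 for a constant `c` and a threshold function `s₀(·)` (supplied by
`AndrewsForbes2022_lemma_6_7_holds` in `AndrewsForbes2022_thm_6_8_explicit`); under the explicit
conditions `IterHyp c s₀ (char F) s Δ ν r₁ rs` the generator `G_k = iterGen ν r₁ rs` hits the
closure of the `ν²`-variate circuits of wire size `s` and product-depth `Δ` over `F((ε))`.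
Proof = the printed induction (p0034:L59–p0034:L86): `k = 1` is Lemma 6.7; the step is Lemma 6.7
for the inner generator `𝒢_{ν_{k-1},ν_{k-1},r_k}` against the compositions `Φ ∘ G_{k-1}` (wire size
`s_k`, product-depth `Δ + k - 1`), transported to the seed of `G_{k-1}` along the arrangement
(`IsHittingSetGenFor.borderLowDepth_comp_injective`) and composed
(`IsHittingSetGenFor.borderLowDepth_comp`, with the coordinate circuits of
`mem_productDepthEdgeClass_iterGen`). [cite: AndrewsForbes2022, Thm. 6.8] -/
theorem iterGen_isHittingSetGenFor {F : Type} [Field F] {c : ℝ} {S₀ : ℕ → ℕ}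
    (H : ∀ Δ : ℕ, 1 ≤ Δ → ∀ ν s : ℕ, S₀ Δ ≤ s → (ringChar F = 0 ∨ s ^ Δ < ringChar F) →
      ∀ r : ℕ, rankThreshold c s Δ ≤ r →
        IsHittingSetGenFor F
          (borderClass F (productDepthEdgeClass (LaurentSeries F) (Fin ν × Fin ν) s Δ))
          (matrixGenerator F ν ν (r - 1)))
    {Δ : ℕ} (hΔ : 1 ≤ Δ) (s ν r₁ : ℕ) :
    ∀ rs : List ℕ, IterHyp c S₀ (ringChar F) s Δ ν r₁ rs →
      IsHittingSetGenFor F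
        (borderClass F (productDepthEdgeClass (LaurentSeries F) (Fin ν × Fin ν) s Δ))
        (iterGen F ν r₁ rs)
  | [], ⟨hs, hp, hr⟩ => by
    have h67 := H Δ hΔ ν s hs hp (r₁ + 1) (by push_cast; exact hr)
    rwa [Nat.add_sub_cancel] at h67
  | r :: rs, ⟨hrs, hs, hp, hr⟩ => by
    have ih := iterGen_isHittingSetGenFor H hΔ s ν r₁ rs hrs
    -- Lemma 6.7 for the inner generator against the compositions `Φ ∘ G_{k-1}`
    have h67 := H (Δ + (rs.length + 1)) (by omega) (lastSide ν r₁ (r :: rs)) (compSize s ν r₁ rs)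
      hs hp (r + 1) (by push_cast; exact hr)
    rw [Nat.add_sub_cancel] at h67
    -- transported to the seed variables of `G_{k-1}` along the arrangement, then composed
    exact ih.borderLowDepth_comp (mem_productDepthEdgeClass_iterGen F ν r₁ rs)
      (by rw [compSize, Fintype.card_prod, Fintype.card_fin]) le_rfl
      (h67.borderLowDepth_comp_injective (arrange_injective _ _))

/-- Lemma 6.7, as typed and proved in the tree, supplies the hypothesis `H` of
`iterGen_isHittingSetGenFor`: a universal `c > 0` and a threshold function `s₀ : ℕ → ℕ` (choice
over the typed `∀ Δ ≥ 1, ∃ s₀`). [cite: AndrewsForbes2022, Lemma 6.7] -/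
theorem exists_lemma_6_7_params :
    ∃ c : ℝ, 0 < c ∧ ∃ S₀ : ℕ → ℕ, ∀ (F : Type) [Field F] (Δ : ℕ), 1 ≤ Δ → ∀ ν s : ℕ, S₀ Δ ≤ s →
      (ringChar F = 0 ∨ s ^ Δ < ringChar F) → ∀ r : ℕ, rankThreshold c s Δ ≤ r →
        IsHittingSetGenFor F
          (borderClass F (productDepthEdgeClass (LaurentSeries F) (Fin ν × Fin ν) s Δ))
          (matrixGenerator F ν ν (r - 1)) := by
  obtain ⟨c, hc, h⟩ := AndrewsForbes2022_lemma_6_7_holds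
  choose S₀ hS₀ using h
  refine ⟨c, hc, fun Δ => if hΔ : 1 ≤ Δ then S₀ Δ hΔ else 0, fun F _ Δ hΔ ν s hs hp r hr => ?_⟩
  have hs' : S₀ Δ hΔ ≤ s := by simpa only [dif_pos hΔ] using hs
  exact hS₀ Δ hΔ F ν s hs' hp r hr

end Theorem68

open Proposition72 Theorem68 in
/-- **Andrews–Forbes 2022, Theorem 6.8 — explicit form, PROVED** (every field `F`).  There are a
universal constant `c > 0` and thresholds `s₀ : ℕ → ℕ` (those of Lemma 6.7) such that: for every
field `F`, every product-depth `Δ ≥ 1`, `n = ν²` variables, wire-size bound `s`, and rank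
parameters `r_1`, `[r_k, …, r_2]` satisfying the explicit conditions `IterHyp c s₀ (char F) s Δ ν
r₁ rs` (print: `r_k = 2^{log(s^{1+o(1)})^{1-exp(-c(Δ+k-1))}}`, "`char F = 0`" resp. Rem. 6.9's
"sufficiently large characteristic", `s` large), the generator `G_k = iterGen ν r₁ [r_k, …, r_2]`
of the printed proof satisfies:
(hitting) `G_k` is a hitting set generator for the closure of the `n`-variate circuits of wire
size `s` and product-depth `Δ` over `F((ε))`;
(1) seed length `2 ν_{k-1} r_k` (print: `n^{1/2^k} s^{o(1)}`);
(2) every coordinate has degree `≤ 2^k` (print: `deg(G_k) = 2^k`);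
(3) every coordinate is computed by a circuit of product-depth `≤ k` with `≤ W_k` wires
(`iterWBound`), and all `n` coordinates JOINTLY by one gate list of `≤ T_k` wires, every
product gate of fan-in `≤ 2`, with output operands of product-depth `≤ k` (`iterTBound`; print: "a
circuit of product-depth `k` and size `n s^{o(1)}`.  Moreover, each product gate in this circuit
has fan-in `2`", multi-output).
The asymptotic reading of (1)–(3) is `AndrewsForbes2022_thm_6_8_asymptotic` below; bullet (4)
(Coppersmith) and the fan-in-`2` remark are not formalized. [cite: AndrewsForbes2022, Thm. 6.8] -/
theorem AndrewsForbes2022_thm_6_8_explicit :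
    ∃ c : ℝ, 0 < c ∧ ∃ S₀ : ℕ → ℕ, ∀ (F : Type) [Field F] (Δ : ℕ), 1 ≤ Δ →
      ∀ (s ν r₁ : ℕ) (rs : List ℕ), IterHyp c S₀ (ringChar F) s Δ ν r₁ rs →
        IsHittingSetGenFor F
            (borderClass F (productDepthEdgeClass (LaurentSeries F) (Fin ν × Fin ν) s Δ))
            (iterGen F ν r₁ rs) ∧
          Fintype.card (IterSeed ν r₁ rs) = 2 * (lastSide ν r₁ rs * lastRank r₁ rs) ∧
          (∀ m, (iterGen F ν r₁ rs m).totalDegree ≤ 2 ^ (rs.length + 1)) ∧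
          (∀ m, iterGen F ν r₁ rs m ∈
            productDepthEdgeClass F (IterSeed ν r₁ rs) (iterWBound ν r₁ rs) (rs.length + 1)) ∧
          (∃ gs : List (ArithCircuit.Gate F (IterSeed ν r₁ rs)),
            (gs.map ArithCircuit.Gate.fanIn).sum ≤ iterTBound ν r₁ rs ∧
            (∀ g ∈ gs, g.isProd = true → g.fanIn ≤ 2) ∧
            ∀ m : Fin ν × Fin ν, ∃ o : ArithCircuit.Operand F (IterSeed ν r₁ rs),
              (⟨gs, o⟩ : ArithCircuit F (IterSeed ν r₁ rs)).eval = iterGen F ν r₁ rs m ∧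
              (⟨gs, o⟩ : ArithCircuit F (IterSeed ν r₁ rs)).productDepth ≤ rs.length + 1) := by
  obtain ⟨c, hc, S₀, H⟩ := exists_lemma_6_7_params
  exact ⟨c, hc, S₀, fun F _ Δ hΔ s ν r₁ rs h =>
    ⟨iterGen_isHittingSetGenFor (H F) hΔ s ν r₁ rs h, card_iterSeed ν r₁ rs,
      totalDegree_iterGen_le ν r₁ rs, mem_productDepthEdgeClass_iterGen F ν r₁ rs,
      exists_jointGates_iterGen F ν r₁ rs⟩⟩

/-! ## The printed asymptotic form of Thm. 6.8 (1)–(3), for fixed `k` and fixed `Δ` -/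

section Asymptotic

namespace Theorem68

open Proposition72

/-- **`2^{(log₂ X)^{1 - exp(-cΔ')}} ≤ X^{o(1)}`** (p0035:L2–L19: "`r_k = 2^{log(s^{1+o(1)})^{1 -
exp(-c(Δ+k-1))}} ≤ 2^{o(log s)} ≤ s^{o(1)}`", here for FIXED `Δ'`): for every `η > 0`,
`rankThreshold c X Δ' + 1 ≤ X^η` for all large `X` (the `+ 1` absorbs the rounding `r = ⌈·⌉`).
[cite: AndrewsForbes2022, Thm. 6.8 (proof, "Seed length")] -/
theorem rankThreshold_add_one_le_rpow {c : ℝ} (hc : 0 < c) {Δ' : ℕ} (hΔ' : 1 ≤ Δ') {η : ℝ}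
    (hη : 0 < η) : ∃ X₀ : ℕ, ∀ X : ℕ, X₀ ≤ X → rankThreshold c X Δ' + 1 ≤ (X : ℝ) ^ η := by
  -- `b = exp(-c Δ') ∈ (0, 1)`
  obtain ⟨b, hb⟩ : ∃ b : ℝ, b = Real.exp (-(c * Δ')) := ⟨_, rfl⟩
  have hb0 : 0 < b := by rw [hb]; exact Real.exp_pos _
  have hb1 : b < 1 := by
    rw [hb, Real.exp_lt_one_iff]
    have : (0 : ℝ) < c * Δ' := mul_pos hc (by exact_mod_cast hΔ')
    linarith
  have h2η : 0 < 2 / η := by positivity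
  -- `u₀ := max 1 (max (2/η) ((2/η)^{1/b}))`, `X₀ := max 2 ⌈2^{u₀}⌉`
  obtain ⟨u₀, hu₀⟩ : ∃ u₀ : ℝ, u₀ = max 1 (max (2 / η) ((2 / η) ^ (1 / b))) := ⟨_, rfl⟩
  refine ⟨max 2 ⌈(2 : ℝ) ^ u₀⌉₊, fun X hX => ?_⟩
  have hX2 : (2 : ℝ) ≤ X := by exact_mod_cast (le_max_left _ _).trans hX
  have hX0 : (0 : ℝ) < X := by linarith
  obtain ⟨u, hu⟩ : ∃ u : ℝ, u = Real.logb 2 X := ⟨_, rfl⟩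
  have hu₀u : u₀ ≤ u := by
    have h1 : (2 : ℝ) ^ u₀ ≤ X :=
      (Nat.le_ceil _).trans (by exact_mod_cast (le_max_right _ _).trans hX)
    have h2 := Real.logb_le_logb_of_le one_lt_two (Real.rpow_pos_of_pos two_pos _) h1
    rwa [Real.logb_rpow two_pos (by norm_num), ← hu] at h2
  have hu1 : 1 ≤ u := by rw [hu₀] at hu₀u; exact (le_max_left _ _).trans hu₀u
  have hupos : 0 < u := by linarith
  have huη : 2 / η ≤ u := by
    rw [hu₀] at hu₀u; exact ((le_max_left _ _).trans (le_max_right _ _)).trans hu₀u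
  have hub : (2 / η) ^ (1 / b) ≤ u := by
    rw [hu₀] at hu₀u; exact ((le_max_right _ _).trans (le_max_right _ _)).trans hu₀u
  -- `u^b ≥ 2/η`
  have hub' : 2 / η ≤ u ^ b := by
    have := Real.rpow_le_rpow (Real.rpow_nonneg h2η.le _) hub hb0.le
    rwa [← Real.rpow_mul h2η.le, one_div_mul_cancel hb0.ne', Real.rpow_one] at this
  have hηu : 2 ≤ η * u := by
    have := (div_le_iff₀ hη).mp huη
    linarith
  -- `u^{1-b} ≤ η u - 1`
  have hkey : u ^ (1 - b) ≤ η * u - 1 := by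
    rw [Real.rpow_sub hupos, Real.rpow_one, div_le_iff₀ (Real.rpow_pos_of_pos hupos b)]
    have hη0 : η ≠ 0 := hη.ne'
    calc u ≤ 2 * u - 2 / η := by linarith
      _ = (η * u - 1) * (2 / η) := by field_simp
      _ ≤ (η * u - 1) * u ^ b := mul_le_mul_of_nonneg_left hub' (by linarith)
  -- `2^{u^{1-b}} ≤ 2^{ηu - 1} = X^η / 2` and `X^η ≥ 2`
  have hXη : (X : ℝ) ^ η = (2 : ℝ) ^ (η * u) := by
    rw [hu, mul_comm, Real.rpow_mul (by norm_num : (0 : ℝ) ≤ 2), Real.rpow_logb two_pos (by norm_num) hX0]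
  have h1 : rankThreshold c X Δ' ≤ (X : ℝ) ^ η / 2 := by
    unfold rankThreshold
    rw [← hb, ← hu]
    calc (2 : ℝ) ^ (u ^ (1 - b)) ≤ (2 : ℝ) ^ (η * u - 1) :=
          Real.rpow_le_rpow_of_exponent_le one_le_two hkey
      _ = (X : ℝ) ^ η / 2 := by rw [Real.rpow_sub two_pos, Real.rpow_one, hXη]
  have h3 : (2 : ℝ) ≤ (X : ℝ) ^ η := by
    rw [hXη]
    calc (2 : ℝ) = 2 ^ (1 : ℝ) := (Real.rpow_one 2).symm
      _ ≤ 2 ^ (η * u) := Real.rpow_le_rpow_of_exponent_le one_le_two (by linarith)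
  linarith

/-- The rank parameter at threshold `X` and product-depth `Δ'`: `⌈2^{(log₂ X)^{1-exp(-cΔ')}}⌉`.
[cite: AndrewsForbes2022, Thm. 6.8 (proof)] -/
def rankAt (c : ℝ) (X Δ' : ℕ) : ℕ := ⌈rankThreshold c X Δ'⌉₊

/-- `rankAt` meets the threshold of `IterHyp`. [cite: AndrewsForbes2022, Thm. 6.8 (proof)] -/
theorem rankThreshold_le_rankAt_add_one (c : ℝ) (X Δ' : ℕ) :
    rankThreshold c X Δ' ≤ (rankAt c X Δ' : ℝ) + 1 :=
  (Nat.le_ceil _).trans (by simp [rankAt])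

/-- `rankAt ≤ rankThreshold + 1`. [cite: AndrewsForbes2022, Thm. 6.8 (proof)] -/
theorem rankAt_le (c : ℝ) (X Δ' : ℕ) : (rankAt c X Δ' : ℝ) ≤ rankThreshold c X Δ' + 1 := by
  have h0 : 0 ≤ rankThreshold c X Δ' := by unfold rankThreshold; positivity
  exact (Nat.ceil_lt_add_one h0).le

set_option maxHeartbeats 1600000 in
/-- **The parameter analysis of Thm. 6.8** (p0034:L88–p0035:L27), quantitative, for FIXED `Δ`
and characteristic `0` (`p = 0` in `IterHyp`): for every number `j + 1` of steps and every
`δ ∈ (0, 1]`, for all large `s` and all `1 ≤ ν`, `ν² ≤ s` there are ranks `r_1, [r_{j+1}, …, r_2]`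
(`rankAt` at each step) satisfying `IterHyp`, with seed length `2 ν_j r_{j+1} ≤ ν^{2/2^{j+1}} s^δ`
(`= n^{1/2^{j+1}} s^δ`), joint wire bound `T_{j+1} ≤ ν² s^δ = n s^δ` and coordinate wire bound
`W_{j+1} ≤ ν s^δ`.  Induction on `j` as in print: the new wire size is `s_{j+1} ≤ 2 s³`, so
`r_{j+1} ≤ s^{o(1)}` (`rankThreshold_add_one_le_rpow`); `ν_j ≤ √(n_j) + 1`; constants are
absorbed by `s ≥ s₀`. [cite: AndrewsForbes2022, Thm. 6.8 (proof)] -/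
theorem exists_params {c : ℝ} (hc : 0 < c) (S₀ : ℕ → ℕ) {Δ : ℕ} (hΔ : 1 ≤ Δ) :
    ∀ (j : ℕ) (δ : ℝ), 0 < δ → δ ≤ 1 → ∃ s₁ : ℕ, ∀ s : ℕ, s₁ ≤ s → ∀ ν : ℕ, 1 ≤ ν → ν * ν ≤ s →
      ∃ (r₁ : ℕ) (rs : List ℕ), rs.length = j ∧ IterHyp c S₀ 0 s Δ ν r₁ rs ∧
        ((2 * (lastSide ν r₁ rs * lastRank r₁ rs) : ℕ) : ℝ) ≤
            (ν : ℝ) ^ ((2 : ℝ) / 2 ^ (j + 1)) * (s : ℝ) ^ δ ∧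
        ((iterTBound ν r₁ rs : ℕ) : ℝ) ≤ (ν : ℝ) * ν * (s : ℝ) ^ δ ∧
        ((iterWBound ν r₁ rs : ℕ) : ℝ) ≤ (ν : ℝ) * (s : ℝ) ^ δ := by
  intro j
  induction j with
  | zero =>
    intro δ hδ hδ1
    obtain ⟨X₀, hX₀⟩ := rankThreshold_add_one_le_rpow hc hΔ (η := δ / 2) (by positivity)
    obtain ⟨s₂, hs₂⟩ := exists_le_rpow_of_pos 3 (ε := δ / 2) (by positivity)
    refine ⟨max (max 1 X₀) (max s₂ (S₀ Δ)), fun s hs ν hν hνs => ?_⟩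
    have hs1 : 1 ≤ s := le_trans (le_max_left _ _) ((le_max_left _ _).trans hs)
    have hsX : X₀ ≤ s := le_trans (le_max_right _ _) ((le_max_left _ _).trans hs)
    have hss₂ : s₂ ≤ s := le_trans (le_max_left _ _) ((le_max_right _ _).trans hs)
    have hsS : S₀ Δ ≤ s := le_trans (le_max_right _ _) ((le_max_right _ _).trans hs)
    have hs1R : (1 : ℝ) ≤ s := by exact_mod_cast hs1
    have hν1R : (1 : ℝ) ≤ ν := by exact_mod_cast hν
    refine ⟨rankAt c s Δ, [], rfl, ⟨hsS, Or.inl rfl, rankThreshold_le_rankAt_add_one c s Δ⟩, ?_⟩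
    -- `r₁ ≤ s^{δ/2}`, `3 ≤ s^{δ/2}`
    have hr : (rankAt c s Δ : ℝ) ≤ (s : ℝ) ^ (δ / 2) := (rankAt_le c s Δ).trans (hX₀ s hsX)
    have h3 : (3 : ℝ) ≤ (s : ℝ) ^ (δ / 2) := hs₂ s hss₂
    have hsq : (s : ℝ) ^ (δ / 2) * (s : ℝ) ^ (δ / 2) = (s : ℝ) ^ δ := by
      rw [← Real.rpow_add (by positivity)]; ring_nf
    have hr0 : (0 : ℝ) ≤ rankAt c s Δ := Nat.cast_nonneg _
    have h3r : 3 * (rankAt c s Δ : ℝ) ≤ (s : ℝ) ^ δ := by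
      rw [← hsq]; nlinarith [hr, h3, hr0]
    refine ⟨?_, ?_, ?_⟩
    · -- seed length `2 ν r₁ ≤ ν s^δ`
      change ((2 * (ν * rankAt c s Δ) : ℕ) : ℝ) ≤ (ν : ℝ) ^ ((2 : ℝ) / 2 ^ (0 + 1)) * (s : ℝ) ^ δ
      have he : (ν : ℝ) ^ ((2 : ℝ) / 2 ^ (0 + 1)) = ν := by norm_num
      rw [he]
      push_cast
      nlinarith [h3r, hν1R, hr0]
    · -- joint wires `ν² · 3 r₁ ≤ ν² s^δ`
      change ((ν * ν * (3 * rankAt c s Δ) : ℕ) : ℝ) ≤ (ν : ℝ) * ν * (s : ℝ) ^ δ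
      push_cast
      have hνν : (0 : ℝ) ≤ (ν : ℝ) * ν := by positivity
      nlinarith [h3r, hνν]
    · -- coordinate wires `3 r₁ ≤ ν s^δ`
      change ((3 * rankAt c s Δ : ℕ) : ℝ) ≤ (ν : ℝ) * (s : ℝ) ^ δ
      push_cast
      have hsδ0 : (0 : ℝ) ≤ (s : ℝ) ^ δ := by positivity
      nlinarith [h3r, hν1R, hsδ0]
  | succ j ih =>
    intro δ hδ hδ1
    obtain ⟨s₁, hs₁⟩ := ih (δ / 4) (by positivity) (by linarith)
    obtain ⟨X₀, hX₀⟩ := rankThreshold_add_one_le_rpow hc (Δ' := Δ + (j + 1)) (by omega)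
      (η := δ / 24) (by positivity)
    obtain ⟨s₂, hs₂⟩ := exists_le_rpow_of_pos 8 (ε := δ / 4) (by positivity)
    refine ⟨max (max 1 X₀) (max (max s₁ s₂) (S₀ (Δ + (j + 1)))), fun s hs ν hν hνs => ?_⟩
    have hs1 : 1 ≤ s := le_trans (le_max_left _ _) ((le_max_left _ _).trans hs)
    have hsX : X₀ ≤ s := le_trans (le_max_right _ _) ((le_max_left _ _).trans hs)
    have hss₁ : s₁ ≤ s :=
      le_trans (le_max_left _ _) ((le_max_left _ _).trans ((le_max_right _ _).trans hs))
    have hss₂ : s₂ ≤ s :=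
      le_trans (le_max_right _ _) ((le_max_left _ _).trans ((le_max_right _ _).trans hs))
    have hsS : S₀ (Δ + (j + 1)) ≤ s := le_trans (le_max_right _ _) ((le_max_right _ _).trans hs)
    have hs1R : (1 : ℝ) ≤ s := by exact_mod_cast hs1
    have hν1R : (1 : ℝ) ≤ ν := by exact_mod_cast hν
    have hνsR : (ν : ℝ) ≤ s := by
      have h1 : ν ≤ ν * ν := Nat.le_mul_self ν
      exact_mod_cast h1.trans hνs
    have hννs : (ν : ℝ) * ν ≤ s := by exact_mod_cast hνs
    obtain ⟨r₁, rs, hlen, hhyp, hL, hT, hW⟩ := hs₁ s hss₁ ν hν hνs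
    -- the data of the previous generator
    obtain ⟨a, ha⟩ : ∃ a : ℕ, a = lastSide ν r₁ rs := ⟨_, rfl⟩
    obtain ⟨ρ, hρ⟩ : ∃ ρ : ℕ, ρ = lastRank r₁ rs := ⟨_, rfl⟩
    obtain ⟨W, hWdef⟩ : ∃ W : ℕ, W = iterWBound ν r₁ rs := ⟨_, rfl⟩
    obtain ⟨T, hTdef⟩ : ∃ T : ℕ, T = iterTBound ν r₁ rs := ⟨_, rfl⟩
    obtain ⟨ν', hν'⟩ : ∃ ν' : ℕ, ν' = ceilSqrt (a * ρ + ρ * a) := ⟨_, rfl⟩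
    obtain ⟨X, hX⟩ : ∃ X : ℕ, X = compSize s ν r₁ rs := ⟨_, rfl⟩
    have hside : ∀ r, lastSide ν r₁ (r :: rs) = ν' := fun r => by rw [hν', ha, hρ]; rfl
    have hlen' : Δ + (rs.length + 1) = Δ + (j + 1) := by rw [hlen]
    obtain ⟨r, hr⟩ : ∃ r : ℕ, r = rankAt c X (Δ + (j + 1)) := ⟨_, rfl⟩
    have hsX' : s ≤ X := by rw [hX, compSize]; exact Nat.le_add_right _ _
    refine ⟨r₁, r :: rs, by rw [List.length_cons, hlen], ⟨hhyp, ?_, Or.inl rfl, ?_⟩, ?_⟩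
    · rw [hlen', ← hX]; exact hsS.trans hsX'
    · rw [hlen', ← hX, hr]; exact rankThreshold_le_rankAt_add_one c X _
    rw [← ha, ← hρ] at hL
    rw [← hTdef] at hT
    rw [← hWdef] at hW
    -- real-number bookkeeping
    have hL0 : (0 : ℝ) ≤ ((2 * (a * ρ) : ℕ) : ℝ) := Nat.cast_nonneg _
    have hspos : ∀ e : ℝ, (0 : ℝ) < (s : ℝ) ^ e := fun e => Real.rpow_pos_of_pos (by positivity) e
    have hsle : ∀ e : ℝ, e ≤ 1 → (s : ℝ) ^ e ≤ s := fun e he => by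
      calc (s : ℝ) ^ e ≤ (s : ℝ) ^ (1 : ℝ) := Real.rpow_le_rpow_of_exponent_le hs1R he
        _ = s := Real.rpow_one _
    have hs4_1 : (1 : ℝ) ≤ (s : ℝ) ^ (δ / 4) := Real.one_le_rpow hs1R (by positivity)
    have h8 : (8 : ℝ) ≤ (s : ℝ) ^ (δ / 4) := hs₂ s hss₂
    have hνe_le : ∀ e : ℝ, e ≤ 1 → (ν : ℝ) ^ e ≤ ν := fun e he => by
      calc (ν : ℝ) ^ e ≤ (ν : ℝ) ^ (1 : ℝ) := Real.rpow_le_rpow_of_exponent_le hν1R he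
        _ = ν := Real.rpow_one _
    have he1 : (2 : ℝ) / 2 ^ (j + 1) ≤ 1 := by
      rw [div_le_one (by positivity)]
      calc (2 : ℝ) = 2 ^ (0 + 1) := by norm_num
        _ ≤ 2 ^ (j + 1) := pow_le_pow_right₀ (by norm_num) (by omega)
    -- `L ≤ ν s^{δ/4}`, `W ≤ s²`, `X ≤ 2 s³`
    have hLν : ((2 * (a * ρ) : ℕ) : ℝ) ≤ (ν : ℝ) * (s : ℝ) ^ (δ / 4) :=
      hL.trans (mul_le_mul_of_nonneg_right (hνe_le _ he1) (hspos _).le)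
    have hWs : (W : ℝ) ≤ (s : ℝ) * s :=
      hW.trans (mul_le_mul hνsR (hsle _ (by linarith)) (hspos _).le (by positivity))
    have hXle : (X : ℝ) ≤ 2 * (s : ℝ) ^ (3 : ℝ) := by
      rw [hX, compSize, ← hWdef]
      push_cast
      have h3 : (s : ℝ) ^ (3 : ℝ) = s * (s * s) := by
        rw [show (3 : ℝ) = ((3 : ℕ) : ℝ) by norm_num, Real.rpow_natCast]; ring
      rw [h3]
      have hs0 : (0 : ℝ) ≤ s := by positivity
      have hss1 : (s : ℝ) ≤ s * (s * s) := by nlinarith [hs1R]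
      nlinarith [hννs, hWs, mul_nonneg hs0 hs0]
    -- hence `r ≤ 2 s^{δ/8}`
    have hrle : (r : ℝ) ≤ 2 * (s : ℝ) ^ (δ / 8) := by
      rw [hr]
      refine (rankAt_le c X _).trans ((hX₀ X (hsX.trans hsX')).trans ?_)
      calc (X : ℝ) ^ (δ / 24) ≤ (2 * (s : ℝ) ^ (3 : ℝ)) ^ (δ / 24) :=
            Real.rpow_le_rpow (Nat.cast_nonneg _) hXle (by positivity)
        _ = (2 : ℝ) ^ (δ / 24) * (s : ℝ) ^ (δ / 8) := by
            rw [Real.mul_rpow (by norm_num) (by positivity), ← Real.rpow_mul (by positivity)]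
            ring_nf
        _ ≤ 2 * (s : ℝ) ^ (δ / 8) := by
            refine mul_le_mul_of_nonneg_right ?_ (by positivity)
            calc (2 : ℝ) ^ (δ / 24) ≤ (2 : ℝ) ^ (1 : ℝ) :=
                  Real.rpow_le_rpow_of_exponent_le (by norm_num) (by linarith)
              _ = 2 := Real.rpow_one _
    have hr0 : (0 : ℝ) ≤ r := Nat.cast_nonneg _
    have hs8le4 : (s : ℝ) ^ (δ / 8) ≤ (s : ℝ) ^ (δ / 4) :=
      Real.rpow_le_rpow_of_exponent_le hs1R (by linarith)
    have hr4 : (r : ℝ) ≤ 2 * (s : ℝ) ^ (δ / 4) := hrle.trans (by linarith)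
    -- `ν' ≤ √L + 1 ≤ 2 ν^{1/2^{j+1}} s^{δ/8}`
    have hsqrtL : Real.sqrt ((2 * (a * ρ) : ℕ) : ℝ) ≤
        (ν : ℝ) ^ ((2 : ℝ) / 2 ^ (j + 2)) * (s : ℝ) ^ (δ / 8) := by
      rw [Real.sqrt_eq_rpow]
      calc (((2 * (a * ρ) : ℕ) : ℝ)) ^ ((1 : ℝ) / 2)
          ≤ ((ν : ℝ) ^ ((2 : ℝ) / 2 ^ (j + 1)) * (s : ℝ) ^ (δ / 4)) ^ ((1 : ℝ) / 2) :=
            Real.rpow_le_rpow hL0 hL (by norm_num)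
        _ = (ν : ℝ) ^ ((2 : ℝ) / 2 ^ (j + 2)) * (s : ℝ) ^ (δ / 8) := by
            rw [Real.mul_rpow (by positivity) (by positivity), ← Real.rpow_mul (by positivity),
              ← Real.rpow_mul (by positivity)]
            congr 1 <;> ring_nf
    have hν'R : (ν' : ℝ) ≤ Real.sqrt ((2 * (a * ρ) : ℕ) : ℝ) + 1 := by
      rw [hν']
      have : ((a * ρ + ρ * a : ℕ) : ℝ) = ((2 * (a * ρ) : ℕ) : ℝ) := by push_cast; ring
      rw [← this]
      exact ceilSqrt_le_sqrt_add_one _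
    have hνe0 : (0 : ℝ) ≤ (ν : ℝ) ^ ((2 : ℝ) / 2 ^ (j + 2)) := by positivity
    have hpow2 : (1 : ℝ) ≤ (ν : ℝ) ^ ((2 : ℝ) / 2 ^ (j + 2)) * (s : ℝ) ^ (δ / 8) :=
      one_le_mul_of_one_le_of_one_le (Real.one_le_rpow hν1R (by positivity))
        (Real.one_le_rpow hs1R (by positivity))
    have hν'le : (ν' : ℝ) ≤ 2 * ((ν : ℝ) ^ ((2 : ℝ) / 2 ^ (j + 2)) * (s : ℝ) ^ (δ / 8)) := by
      linarith
    -- products of powers of `s`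
    have hs44 : (s : ℝ) ^ (δ / 4) * (s : ℝ) ^ (δ / 4) ≤ (s : ℝ) ^ δ := by
      rw [← Real.rpow_add (by positivity)]
      exact Real.rpow_le_rpow_of_exponent_le hs1R (by linarith)
    have hs444 : (s : ℝ) ^ (δ / 4) * (s : ℝ) ^ (δ / 4) * (s : ℝ) ^ (δ / 4) ≤ (s : ℝ) ^ δ := by
      rw [← Real.rpow_add (by positivity), ← Real.rpow_add (by positivity)]
      exact Real.rpow_le_rpow_of_exponent_le hs1R (by linarith)
    have hA : (0 : ℝ) ≤ (s : ℝ) ^ (δ / 4) := (hspos _).le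
    refine ⟨?_, ?_, ?_⟩
    · -- seed length: `2 ν' r ≤ 2 · 2 ν^{e} s^{δ/8} · 2 s^{δ/8} ≤ ν^{e} s^δ`
      rw [hside]
      change ((2 * (ν' * r) : ℕ) : ℝ) ≤ (ν : ℝ) ^ ((2 : ℝ) / 2 ^ (j + 1 + 1)) * (s : ℝ) ^ δ
      push_cast
      calc (2 : ℝ) * ((ν' : ℝ) * r)
          ≤ 2 * ((2 * ((ν : ℝ) ^ ((2 : ℝ) / 2 ^ (j + 2)) * (s : ℝ) ^ (δ / 8))) *
              (2 * (s : ℝ) ^ (δ / 8))) := by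
            refine mul_le_mul_of_nonneg_left (mul_le_mul hν'le hrle hr0 (by positivity)) (by norm_num)
        _ = (ν : ℝ) ^ ((2 : ℝ) / 2 ^ (j + 2)) * (8 * ((s : ℝ) ^ (δ / 8) * (s : ℝ) ^ (δ / 8))) := by ring
        _ ≤ (ν : ℝ) ^ ((2 : ℝ) / 2 ^ (j + 2)) * ((s : ℝ) ^ (δ / 4) * (s : ℝ) ^ (δ / 4) * (s : ℝ) ^ (δ / 4)) := by
            refine mul_le_mul_of_nonneg_left ?_ hνe0
            have h88 : (s : ℝ) ^ (δ / 8) * (s : ℝ) ^ (δ / 8) ≤ (s : ℝ) ^ (δ / 4) * (s : ℝ) ^ (δ / 4) :=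
              mul_le_mul hs8le4 hs8le4 (hspos _).le hA
            calc (8 : ℝ) * ((s : ℝ) ^ (δ / 8) * (s : ℝ) ^ (δ / 8))
                ≤ (s : ℝ) ^ (δ / 4) * ((s : ℝ) ^ (δ / 4) * (s : ℝ) ^ (δ / 4)) :=
                  mul_le_mul h8 h88 (by positivity) hA
              _ = (s : ℝ) ^ (δ / 4) * (s : ℝ) ^ (δ / 4) * (s : ℝ) ^ (δ / 4) := by ring
        _ ≤ (ν : ℝ) ^ ((2 : ℝ) / 2 ^ (j + 1 + 1)) * (s : ℝ) ^ δ :=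
            mul_le_mul_of_nonneg_left hs444 hνe0
    · -- joint wires: `T + L · 3 r ≤ ν² s^{δ/4} + ν s^{δ/4} · 6 s^{δ/4} ≤ ν² s^δ`
      rw [show iterTBound ν r₁ (r :: rs) = T + 2 * (a * ρ) * (3 * r) by
        rw [iterTBound, hTdef, ha, hρ]]
      push_cast
      have hLν' : (2 : ℝ) * (a * ρ) ≤ (ν : ℝ) * (s : ℝ) ^ (δ / 4) := by exact_mod_cast hLν
      have hνν1 : (ν : ℝ) ≤ (ν : ℝ) * ν := by nlinarith [hν1R]
      have hνν0 : (0 : ℝ) ≤ (ν : ℝ) * ν := by positivity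
      calc (T : ℝ) + 2 * (a * ρ) * (3 * r)
          ≤ (ν : ℝ) * ν * (s : ℝ) ^ (δ / 4) + (ν : ℝ) * (s : ℝ) ^ (δ / 4) * (3 * (2 * (s : ℝ) ^ (δ / 4))) := by
            refine add_le_add hT (mul_le_mul hLν' (by linarith) (by positivity) (by positivity))
        _ ≤ (ν : ℝ) * ν * (s : ℝ) ^ (δ / 4) + (ν : ℝ) * ν * (s : ℝ) ^ (δ / 4) * (6 * (s : ℝ) ^ (δ / 4)) := by
            have : (ν : ℝ) * (s : ℝ) ^ (δ / 4) * (3 * (2 * (s : ℝ) ^ (δ / 4))) ≤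
                (ν : ℝ) * ν * (s : ℝ) ^ (δ / 4) * (6 * (s : ℝ) ^ (δ / 4)) := by
              have e : (3 : ℝ) * (2 * (s : ℝ) ^ (δ / 4)) = 6 * (s : ℝ) ^ (δ / 4) := by ring
              rw [e]
              exact mul_le_mul_of_nonneg_right (mul_le_mul_of_nonneg_right hνν1 hA) (by positivity)
            linarith
        _ = (ν : ℝ) * ν * ((s : ℝ) ^ (δ / 4) * (1 + 6 * (s : ℝ) ^ (δ / 4))) := by ring
        _ ≤ (ν : ℝ) * ν * ((s : ℝ) ^ (δ / 4) * (s : ℝ) ^ (δ / 4) * (s : ℝ) ^ (δ / 4)) := by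
            refine mul_le_mul_of_nonneg_left ?_ hνν0
            have h7 : (1 : ℝ) + 6 * (s : ℝ) ^ (δ / 4) ≤ 7 * (s : ℝ) ^ (δ / 4) := by linarith
            have h7' : (7 : ℝ) * (s : ℝ) ^ (δ / 4) ≤ (s : ℝ) ^ (δ / 4) * (s : ℝ) ^ (δ / 4) :=
              mul_le_mul_of_nonneg_right (by linarith) hA
            calc (s : ℝ) ^ (δ / 4) * (1 + 6 * (s : ℝ) ^ (δ / 4))
                ≤ (s : ℝ) ^ (δ / 4) * ((s : ℝ) ^ (δ / 4) * (s : ℝ) ^ (δ / 4)) :=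
                  mul_le_mul_of_nonneg_left (h7.trans h7') hA
              _ = (s : ℝ) ^ (δ / 4) * (s : ℝ) ^ (δ / 4) * (s : ℝ) ^ (δ / 4) := by ring
        _ ≤ (ν : ℝ) * ν * (s : ℝ) ^ δ := mul_le_mul_of_nonneg_left hs444 hνν0
    · -- coordinate wires: `W + L · 3 r ≤ ν s^{δ/4} + ν s^{δ/4} · 6 s^{δ/4} ≤ ν s^δ`
      rw [show iterWBound ν r₁ (r :: rs) = W + 2 * (a * ρ) * (3 * r) by
        rw [iterWBound, hWdef, ha, hρ]]
      push_cast
      have hLν' : (2 : ℝ) * (a * ρ) ≤ (ν : ℝ) * (s : ℝ) ^ (δ / 4) := by exact_mod_cast hLν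
      have hν0 : (0 : ℝ) ≤ (ν : ℝ) := by positivity
      calc (W : ℝ) + 2 * (a * ρ) * (3 * r)
          ≤ (ν : ℝ) * (s : ℝ) ^ (δ / 4) + (ν : ℝ) * (s : ℝ) ^ (δ / 4) * (3 * (2 * (s : ℝ) ^ (δ / 4))) := by
            refine add_le_add hW (mul_le_mul hLν' (by linarith) (by positivity) (by positivity))
        _ = (ν : ℝ) * ((s : ℝ) ^ (δ / 4) * (1 + 6 * (s : ℝ) ^ (δ / 4))) := by ring
        _ ≤ (ν : ℝ) * ((s : ℝ) ^ (δ / 4) * (s : ℝ) ^ (δ / 4) * (s : ℝ) ^ (δ / 4)) := by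
            refine mul_le_mul_of_nonneg_left ?_ hν0
            have h7 : (1 : ℝ) + 6 * (s : ℝ) ^ (δ / 4) ≤ 7 * (s : ℝ) ^ (δ / 4) := by linarith
            have h7' : (7 : ℝ) * (s : ℝ) ^ (δ / 4) ≤ (s : ℝ) ^ (δ / 4) * (s : ℝ) ^ (δ / 4) :=
              mul_le_mul_of_nonneg_right (by linarith) hA
            calc (s : ℝ) ^ (δ / 4) * (1 + 6 * (s : ℝ) ^ (δ / 4))
                ≤ (s : ℝ) ^ (δ / 4) * ((s : ℝ) ^ (δ / 4) * (s : ℝ) ^ (δ / 4)) :=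
                  mul_le_mul_of_nonneg_left (h7.trans h7') hA
              _ = (s : ℝ) ^ (δ / 4) * (s : ℝ) ^ (δ / 4) * (s : ℝ) ^ (δ / 4) := by ring
        _ ≤ (ν : ℝ) * (s : ℝ) ^ δ := mul_le_mul_of_nonneg_left hs444 hν0

end Theorem68

open Proposition72 Theorem68 in
/-- **Andrews–Forbes 2022, Theorem 6.8, bullets (1)–(3) in the printed asymptotic form — PROVED**
(`char F = 0`, as printed; for each FIXED product-depth `Δ` — see the module docstring for the
rate hypothesis).  For every fixed `k ≥ 1`, every fixed `Δ ≥ 1` and every `δ > 0` there is `s₀`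
such that for every field `F` of characteristic zero, all `s ≥ s₀` and all `n = ν²` with
`1 ≤ ν`, `n ≤ s`, there are ranks `r_1, [r_k, …, r_2]` (those of the printed proof,
`r_j = ⌈2^{(log₂ s_j)^{1-exp(-c(Δ+j-1))}}⌉` with `c`, `s_j` from Lemma 6.7 and the composition,
`Theorem68.rankAt`) for which the generator `G_k = iterGen ν r₁ [r_k, …, r_2]`
(hitting) is a hitting set generator for the closure of the `n`-variate circuits of wire size `s`
and product-depth `Δ` over `F((ε))`, and has
(1) seed length `≤ n^{1/2^k} · s^δ` (print: `n^{1/2^k} s^{o(1)}`),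
(2) coordinates of degree `≤ 2^k` (print: `deg(G_k) = 2^k`),
(3) ONE gate list of total wire size `≤ n · s^δ`, every product gate of fan-in `≤ 2`,
computing every coordinate as an output of product-depth `≤ k` (print: "`G_k` can be computed by
a circuit of product-depth `k` and size `n s^{o(1)}`.  Moreover, each product gate in this circuit
has fan-in `2`"; bullet (4) is not formalized).
[cite: AndrewsForbes2022, Thm. 6.8] -/
theorem AndrewsForbes2022_thm_6_8_asymptotic (k Δ : ℕ) (hk : 1 ≤ k) (hΔ : 1 ≤ Δ) (δ : ℝ)
    (hδ : 0 < δ) :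
    ∃ s₀ : ℕ, ∀ (F : Type) [Field F] [CharZero F] (s : ℕ), s₀ ≤ s → ∀ ν : ℕ, 1 ≤ ν → ν * ν ≤ s →
      ∃ (r₁ : ℕ) (rs : List ℕ), rs.length + 1 = k ∧
        IsHittingSetGenFor F
            (borderClass F (productDepthEdgeClass (LaurentSeries F) (Fin ν × Fin ν) s Δ))
            (iterGen F ν r₁ rs) ∧
        (Fintype.card (IterSeed ν r₁ rs) : ℝ) ≤ ((ν * ν : ℕ) : ℝ) ^ ((1 : ℝ) / 2 ^ k) * (s : ℝ) ^ δ ∧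
        (∀ m, (iterGen F ν r₁ rs m).totalDegree ≤ 2 ^ k) ∧
        ∃ gs : List (ArithCircuit.Gate F (IterSeed ν r₁ rs)),
          ((gs.map ArithCircuit.Gate.fanIn).sum : ℝ) ≤ ((ν * ν : ℕ) : ℝ) * (s : ℝ) ^ δ ∧
          (∀ g ∈ gs, g.isProd = true → g.fanIn ≤ 2) ∧
          ∀ m : Fin ν × Fin ν, ∃ o : ArithCircuit.Operand F (IterSeed ν r₁ rs),
            (⟨gs, o⟩ : ArithCircuit F (IterSeed ν r₁ rs)).eval = iterGen F ν r₁ rs m ∧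
            (⟨gs, o⟩ : ArithCircuit F (IterSeed ν r₁ rs)).productDepth ≤ k := by
  obtain ⟨c, hc, S₀, H⟩ := exists_lemma_6_7_params
  obtain ⟨j, rfl⟩ : ∃ j, k = j + 1 := ⟨k - 1, by omega⟩
  obtain ⟨s₀, hs₀⟩ := exists_params hc S₀ hΔ j (min δ 1) (lt_min hδ one_pos) (min_le_right _ _)
  refine ⟨max 1 s₀, fun F _ _ s hs ν hν hνs => ?_⟩
  have hs1R : (1 : ℝ) ≤ s := by exact_mod_cast (le_max_left _ _).trans hs
  obtain ⟨r₁, rs, hlen, hhyp, hL, hT, -⟩ := hs₀ s ((le_max_right _ _).trans hs) ν hν hνs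
  have hmin : (s : ℝ) ^ (min δ 1) ≤ (s : ℝ) ^ δ :=
    Real.rpow_le_rpow_of_exponent_le hs1R (min_le_left _ _)
  have hchar : ringChar F = 0 := ringChar.eq_zero
  have hhyp' : IterHyp c S₀ (ringChar F) s Δ ν r₁ rs := by rw [hchar]; exact hhyp
  obtain ⟨gs, hgs, h2, hout⟩ := exists_jointGates_iterGen F ν r₁ rs
  refine ⟨r₁, rs, by rw [hlen], iterGen_isHittingSetGenFor (H F) hΔ s ν r₁ rs hhyp', ?_, ?_,
    gs, ?_, h2, fun m => ?_⟩
  · rw [card_iterSeed]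
    refine hL.trans ?_
    have he : ((ν * ν : ℕ) : ℝ) ^ ((1 : ℝ) / 2 ^ (j + 1)) = (ν : ℝ) ^ ((2 : ℝ) / 2 ^ (j + 1)) := by
      push_cast
      rw [← sq, ← Real.rpow_natCast_mul (Nat.cast_nonneg _)]
      congr 1
      push_cast
      ring
    rw [he]
    exact mul_le_mul_of_nonneg_left hmin (by positivity)
  · intro m
    simpa [hlen] using totalDegree_iterGen_le (F := F) ν r₁ rs m
  · calc (((gs.map ArithCircuit.Gate.fanIn).sum : ℕ) : ℝ) ≤ ((iterTBound ν r₁ rs : ℕ) : ℝ) := by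
          exact_mod_cast hgs
      _ ≤ (ν : ℝ) * ν * (s : ℝ) ^ (min δ 1) := hT
      _ ≤ ((ν * ν : ℕ) : ℝ) * (s : ℝ) ^ δ := by
          push_cast
          exact mul_le_mul_of_nonneg_left hmin (by positivity)
  · obtain ⟨o, ho, hoΔ⟩ := hout m
    exact ⟨o, ho, by rw [← hlen]; exact hoΔ⟩

end Asymptotic

end Literature.Computability.AlgebraicComplexity
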